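import Summits.QuantumFields.YangMills.Theorems.BalabanUVNodesN07ChartLogReality
import Summits.QuantumFields.YangMills.Theorems.BalabanUVNodesN07Prop3AtRecord
import Literature.MathematicalPhysics.QuantumFieldTheory.Balaban1983to89.MatrixNorms
import HarnessLib

/-!
# BalabanUVNodes ∕ N07 — A `𝔤`-VALUED RIGHT INVERSE OF THE TRUE LINEARISATION FROM ANY RIGHT INVERSE (Hermitian symmetrisation + trace projection), hence [15] PROPOSITION 3
# AT NODE 00's RECORD OVER PRINT'S REAL LIE ALGEBRA `𝔤 = herm0`: the chart `D(·)` maps Hermitian traceless `A′` to Hermitian traceless `D(A′)`, `A = A′ − HD(A′)` — NO displayed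
# operator hypothesis

Cell `pub-ymgap`, width seat `pub-ymgap-dag-n07-w2` generation 3 (HUMAN RULING D-0149; DAG node N07 = [15] = [Balaban1985Variational]; W-SEAT START LIST §n07 item 2 = S2
«[15] Sect. C (47)–(49), Prop. 3 AT OBJECTS»).  `--kind proof --supports stmt-QuantumFields-20542 --as helper` (K1⁷; count-neutral).  CONSUMED BY NAME, nothing modified: this seat's
`N07Prop3AtRecord.exists_prop3_T4` (the record's right inverse `H` with its (46) letter), `N07ChartDDerivative.exists_chartD_hasFDerivAt` + `exists_eps_chartDDeriv`,
`N07ChartDValued.{walkSum_mem-style bookkeeping}`, `N07ChartLogReality.chartD_valued_herm0`, the route `UnitScaleTilt`'s `Prop8Chart.fderiv_chartLog_zero_apply` + `ChartHInv.exists_linFamily`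
(`D(chartLog)(0) = η·Q^{(j)}`), lit-balaban `MatrixNorms.norm_ntr_le_opNorm` (`|tr X|∕N ≤ ‖X‖`), `B9AdOrthogonal.herm0`, Mathlib `Matrix.l2_opNorm_conjTranspose`.

THE POINT.  The value-module conjunct (hSH) of `N07ChartDValued` ∕ `N07ChartLogReality` — «`H` maps `𝔤`-valued data to `𝔤`-valued fields» — was the one displayed hypothesis left
in the reality of the chart.  It needs NO property of the particular right inverse of record: the linearised constraint `Qlin = D(chartLog η D)(0) = η·Q^{(j)}` is an `ℝ`-combination of
values, so it COMMUTES WITH EVERY `ℝ`-LINEAR MAP OF THE FIBRE applied bondwise (§1); hence from ANY ℂ-linear right inverse `H` with the weighted (46) letter `B₀` one gets the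
ℂ-linear right inverse `H♮ := P₀∘H′ + H′∘(1 − P₀)`, `H′ := ½(H + †∘H∘†)` (`†` = conjugate transpose on values and data, `P₀ = 1 − N⁻¹·tr(·)·1` the trace projection), with letter
`3B₀`, mapping Hermitian traceless data to Hermitian traceless fields (§2).  [15] p. 285 takes `H` real from the start («A with values in 𝔤»); this file is that remark for the
complexified right inverse the tree carries.

WHAT IS PROVED (sorry-free; no definition; axioms standard; fibre `M_N(ℂ)`, `N ≥ 1`).
* §1 `walkSum_comp_linear`, `linAvg_comp_linear`, `linFamily_comp_linear`, ★ `fderiv_chartLog_zero_comp_linear` — `Qlin (f ∘ Y) = f ∘ (Qlin Y)` for every `ℝ`-linear `f` of the fibre.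
* §2 ★★★ `exists_herm0Valued_rightInverse` — generic `P`: from a ℂ-linear `H` with `Qlin ∘ H = id` and the weighted letter `B₀ ≥ 0`, a ℂ-linear `H♮` with `Qlin ∘ H♮ = id`, letter
  `3B₀`, and `X` `herm0`-valued ⇒ `H♮X` `herm0`-valued.
* §3 ★★★★ `exists_prop3_T4_herm0` — [15] PROPOSITION 3 AT NODE 00's RECORD OVER `𝔤`: for every `F : T4Family` there are thresholds `Mh₀, R₀` and `B ≥ 0` such that for all record
  data (binders of `exists_prop3_T4`: `body_of_adm22_T4`'s + `2L ≤ R`), every `ε > 0` with `18C₂Bε ≤ 1`, `64ε ≤ R⋆` and the guard budget `120ℓ²Lε < δ_N`: `∃ H Dfun` with (45)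
  `Qlin ∘ H = id`, (46) letter `B`, **`H` maps `herm0`-valued data to `herm0`-valued fields**, `Dfun` ℂ-differentiable on the weighted `ε`-ball with (55), (49), (48),
  `HasFDerivAt` + (73), **and for Hermitian traceless `A′` in the ball, `Dfun A′` and `A′ − H·Dfun A′` are Hermitian traceless** — NO displayed hypothesis beyond thresholds and windows.

HONEST FRAMING: the record's `H` here is the symmetrised-projected right inverse `H♮` built from dag k0-s1-w1's complexified `H` (itself from the canonical `GQ*(QGQ*)⁻¹` of Cor. 2.8) —
a right inverse with the printed letters, not asserted to coincide with print's `H` on non-`𝔤` data; the guard budget is `N`-dependent through `δ_N` as the tree's (0.4) guard is;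
(73) at norm level; nothing of [15] Sects. D–F asserted; stub 1 ∕ K0⁷ ∕ K1⁷ NOT closed; N07 NOT discharged; counts unmoved (5∕28); one finite T⁴ programme at fixed ε — NOT continuum ∕
ℝ⁴ ∕ OS ∕ mass gap ∕ Clay: the Yang–Mills mass gap is NOT proved by any of this; R4 closes the conditional rung `BalabanLadder.UV` only.  No `sorry`, no `def`, no `instance`, no `notation`.

References: [15] T. Bałaban, CMP 102 (1985) 277–309 [Balaban1985Variational] ((43)–(49) p.285, (55) p.286, (73) p.289, Prop. 3 p.289, (152)–(157) pp.301–302); T. Bałaban, CMP 96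
(1984) 223–250 [Balaban1984PropagatorsII] (Cor. 2.8 p.249); T. Bałaban, CMP 98 (1985) 17–51 [Balaban1985Averaging] ((20) p.21, (124)–(125) p.36); [I] CMP 109 (1987) [Balaban1987RG1] ((0.1) p.251).
-/

noncomputable section

open scoped BigOperators Matrix.Norms.L2Operator
open NormedSpace Metric Set

namespace Summit.QuantumFields.YangMills.BalabanUVNodes.N07ChartHValued

open Literature.MathematicalPhysics.QuantumFieldTheory.Balaban1983to89
open Literature.MathematicalPhysics.QuantumFieldTheory.Balaban1983to89.T4Continuum (T4Family LStep)
open Literature.MathematicalPhysics.QuantumFieldTheory.Balaban1983to89.B6SectADomainsV1 (Domains)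
open Literature.MathematicalPhysics.QuantumFieldTheory.Balaban1983to89.B6SectAOperatorsV1 (BondIdx)
open Literature.MathematicalPhysics.QuantumFieldTheory.Balaban1983to89.B9AdOrthogonal (herm0 mem_herm0)
open Literature.MathematicalPhysics.QuantumFieldTheory.Balaban1983to89.ExpMeanLog (deltaSU)
open BlockAveragingEMLLinearised (linAvg walkSum linAvg_def walkSum_nil walkSum_cons)
open BlockAveraging (Idx)
open MatrixNorms (norm_ntr_le_opNorm)
open Summit.QuantumFields.YangMills.Theorems.FlatCubeOpsText (Adm22)
open Summit.QuantumFields.YangMills.Theorems.K0FlatCubeOpsTextP (IsLevWeight)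
open Summit.QuantumFields.YangMills.Theorems.Prop8Chart (chartLog fderiv_chartLog_zero_apply)
open Summit.QuantumFields.YangMills.Theorems.ChartHInv (exists_linFamily)
open Summit.QuantumFields.YangMills.BalabanUVNodes.N07ChartDDerivative (exists_chartD_hasFDerivAt exists_eps_chartDDeriv)
open Summit.QuantumFields.YangMills.BalabanUVNodes.N07Prop3AtRecord (exists_prop3_T4)
open Summit.QuantumFields.YangMills.BalabanUVNodes.N07ChartLogReality (chartD_valued_herm0)

variable {P : Params} {N : ℕ}

/-! ## §1 The linearised constraint commutes with every `ℝ`-linear map of the fibre -/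

/-- A signed walk sum commutes with an `ℝ`-linear map of the values. [cite: Balaban1984PropagatorsI, (1.8) p.19] -/
theorem walkSum_comp_linear {j : ℕ} (f : Matrix (Fin N) (Fin N) ℂ →ₗ[ℝ] Matrix (Fin N) (Fin N) ℂ) (Y : PBond P j → Matrix (Fin N) (Fin N) ℂ) :
    ∀ γ : List (LStep P j), walkSum (fun b => f (Y b)) γ = f (walkSum Y γ)
  | [] => by rw [walkSum_nil, walkSum_nil, map_zero]
  | s :: γ => by
    rw [walkSum_cons, walkSum_cons, map_add, walkSum_comp_linear f Y γ]
    split_ifs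
    · rfl
    · rw [map_neg]

/-- The straight average `linAvg` (an `|I|⁻¹`-REAL combination of walk sums) commutes with an `ℝ`-linear map of the values. [cite: Balaban1985Averaging, (124)-(125) p.36] -/
theorem linAvg_comp_linear {j : ℕ} (f : Matrix (Fin N) (Fin N) ℂ →ₗ[ℝ] Matrix (Fin N) (Fin N) ℂ) (Y : PBond P j → Matrix (Fin N) (Fin N) ℂ) (c : PBond P (j + 1)) :
    linAvg (fun b => f (Y b)) c = f (linAvg Y c) := by
  rw [linAvg_def, linAvg_def]
  have hcast : ((Fintype.card (Idx P) : ℂ))⁻¹ = (((Fintype.card (Idx P) : ℝ)⁻¹ : ℝ) : ℂ) := by push_cast; rfl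
  rw [hcast, Complex.coe_smul, Complex.coe_smul, map_smul, map_sum]
  congr 1
  refine Finset.sum_congr rfl fun i _ => ?_
  rw [map_sub, map_add, walkSum_comp_linear, walkSum_comp_linear, walkSum_comp_linear]

/-- Every `Q^{(j)}`-family commutes with an `ℝ`-linear map of the values. [cite: Balaban1985Averaging, (124)-(125) p.36] -/
theorem linFamily_comp_linear (f : Matrix (Fin N) (Fin N) ℂ →ₗ[ℝ] Matrix (Fin N) (Fin N) ℂ)
    (Q : (i : ℕ) → (PBond P 0 → Matrix (Fin N) (Fin N) ℂ) → PBond P i → Matrix (Fin N) (Fin N) ℂ)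
    (hQ0 : ∀ Y, Q 0 Y = Y) (hQs : ∀ (i : ℕ) (Y : PBond P 0 → Matrix (Fin N) (Fin N) ℂ) (c : PBond P (i + 1)), Q (i + 1) Y c = linAvg (Q i Y) c) :
    ∀ (j : ℕ) (Y : PBond P 0 → Matrix (Fin N) (Fin N) ℂ) (c : PBond P j), Q j (fun b => f (Y b)) c = f (Q j Y c) := by
  intro j
  induction j with
  | zero => intro Y c; rw [hQ0, hQ0]
  | succ i ih =>
    intro Y c
    rw [hQs, hQs]
    have h : Q i (fun b => f (Y b)) = fun b => f (Q i Y b) := funext fun b => ih Y b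
    rw [h, linAvg_comp_linear]

variable [NeZero N]

omit [NeZero N] in
/-- ★ **THE LINEARISED CONSTRAINT COMMUTES WITH EVERY `ℝ`-LINEAR MAP OF THE FIBRE APPLIED BONDWISE**: `D(chartLog η D)(0) (f ∘ Y) (j, c) = f (D(chartLog η D)(0) Y (j, c))` —
`D(chartLog η D)(0) = η·Q^{(j)}` (`Prop8Chart.fderiv_chartLog_zero_apply`) is a real combination of values. [cite: Balaban1985Variational, (45) p.285, (156)-(157) p.302] -/
theorem fderiv_chartLog_zero_comp_linear (η : ℝ) (D : Domains P) (f : Matrix (Fin N) (Fin N) ℂ →ₗ[ℝ] Matrix (Fin N) (Fin N) ℂ)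
    (Y : PBond P 0 → Matrix (Fin N) (Fin N) ℂ) (idx : BondIdx D) :
    (fderiv ℂ (chartLog η D : (PBond P 0 → Matrix (Fin N) (Fin N) ℂ) → BondIdx D → Matrix (Fin N) (Fin N) ℂ) 0) (fun b => f (Y b)) idx =
      f ((fderiv ℂ (chartLog η D : (PBond P 0 → Matrix (Fin N) (Fin N) ℂ) → BondIdx D → Matrix (Fin N) (Fin N) ℂ) 0) Y idx) := by
  obtain ⟨Q, hQ0, hQs⟩ := exists_linFamily (P := P) (n := Fin N)
  rw [fderiv_chartLog_zero_apply η D Q hQ0 hQs, fderiv_chartLog_zero_apply η D Q hQ0 hQs, linFamily_comp_linear f Q hQ0 hQs,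
    Complex.coe_smul, Complex.coe_smul, map_smul]

/-! ## §2 A Hermitian-traceless-valued right inverse from any right inverse -/

/-- ★★★ **A `𝔤`-VALUED RIGHT INVERSE FROM ANY RIGHT INVERSE.**  For a nested family `D`, level weights `w` (`K0FlatCubeOpsTextP.IsLevWeight`), and a ℂ-linear `H` with
`D(chartLog η D)(0) ∘ H = id` and the weighted (46) letter `B₀`: there is a ℂ-linear `H♮` with `D(chartLog η D)(0) ∘ H♮ = id`, the letter `3B₀`, mapping Hermitian traceless data
(`herm0`-valued `X`) to Hermitian traceless fields — `H♮ = P₀∘H′ + H′∘(1 − P₀)`, `H′ = ½(H + †∘H∘†)`, `P₀ = 1 − N⁻¹tr(·)·1` (§1 gives `Qlin∘† = †∘Qlin`, `Qlin∘P₀ = P₀∘Qlin`;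
`‖X†‖ = ‖X‖`, `|tr X|∕N ≤ ‖X‖`). [cite: Balaban1985Variational, (45)-(46) p.285, (152) p.301, (156)-(157) p.302; Balaban1985Averaging, (20) p.21] -/
theorem exists_herm0Valued_rightInverse (k : ℕ) (D : Domains P) {w : ℕ → PBond P 0 → ℝ} (hw : IsLevWeight P k D w)
    (H : (BondIdx D → Matrix (Fin N) (Fin N) ℂ) →ₗ[ℂ] (PBond P 0 → Matrix (Fin N) (Fin N) ℂ))
    (hHinv : ∀ X, (fderiv ℂ (chartLog (((P.L : ℝ)⁻¹) ^ k) D : (PBond P 0 → Matrix (Fin N) (Fin N) ℂ) → BondIdx D → Matrix (Fin N) (Fin N) ℂ) 0) (H X) = X)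
    {B₀ : ℝ}
    (hHB : ∀ (X : BondIdx D → Matrix (Fin N) (Fin N) ℂ) (t : ℝ), 0 ≤ t → (∀ i, ‖X i‖ ≤ t) → ∀ b, w 1 b * ‖H X b‖ ≤ B₀ * t) :
    ∃ H' : (BondIdx D → Matrix (Fin N) (Fin N) ℂ) →ₗ[ℂ] (PBond P 0 → Matrix (Fin N) (Fin N) ℂ),
      (∀ X, (fderiv ℂ (chartLog (((P.L : ℝ)⁻¹) ^ k) D : (PBond P 0 → Matrix (Fin N) (Fin N) ℂ) → BondIdx D → Matrix (Fin N) (Fin N) ℂ) 0) (H' X) = X) ∧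
      (∀ (X : BondIdx D → Matrix (Fin N) (Fin N) ℂ) (t : ℝ), 0 ≤ t → (∀ i, ‖X i‖ ≤ t) → ∀ b, w 1 b * ‖H' X b‖ ≤ (3 * B₀) * t) ∧
      (∀ X : BondIdx D → Matrix (Fin N) (Fin N) ℂ, (∀ i, X i ∈ herm0 (Fin N)) → ∀ b, H' X b ∈ herm0 (Fin N)) := by
  set Qlin := (fderiv ℂ (chartLog (((P.L : ℝ)⁻¹) ^ k) D : (PBond P 0 → Matrix (Fin N) (Fin N) ℂ) → BondIdx D → Matrix (Fin N) (Fin N) ℂ) 0) with hQlin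
  have hL0 : (0 : ℝ) < P.L := by exact_mod_cast P.L_pos
  have hwpos : ∀ b, 0 < w 1 b := fun b => by rw [hw 1 b, pow_one]; positivity
  have hcard : (0 : ℝ) < Fintype.card (Fin N) := by
    rw [Fintype.card_fin]; exact_mod_cast Nat.pos_of_ne_zero (NeZero.ne N)
  -- the two `ℝ`-linear fibre maps: conjugate transpose `†` and the trace projection `P₀`
  let σ : Matrix (Fin N) (Fin N) ℂ →ₗ[ℝ] Matrix (Fin N) (Fin N) ℂ :=
    { toFun := fun X => star X
      map_add' := fun X Y => star_add X Y
      map_smul' := fun r X => by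
        rw [RingHom.id_apply, Matrix.star_eq_conjTranspose, Matrix.star_eq_conjTranspose, Matrix.conjTranspose_smul, star_trivial] }
  have hσ : ∀ X, σ X = star X := fun _ => rfl
  let P₀ : Matrix (Fin N) (Fin N) ℂ →ₗ[ℂ] Matrix (Fin N) (Fin N) ℂ :=
    LinearMap.id - ((Fintype.card (Fin N) : ℂ)⁻¹ • (Matrix.traceLinearMap (Fin N) ℂ ℂ).smulRight (1 : Matrix (Fin N) (Fin N) ℂ))
  have hP₀ : ∀ X, P₀ X = X - ((Fintype.card (Fin N) : ℂ)⁻¹ * X.trace) • (1 : Matrix (Fin N) (Fin N) ℂ) := fun X => by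
    simp only [P₀, LinearMap.sub_apply, LinearMap.id_apply, LinearMap.smul_apply, LinearMap.smulRight_apply, Matrix.traceLinearMap_apply, smul_smul]
  -- `P₀` of a Hermitian matrix is Hermitian traceless; `P₀` fixes traceless matrices; `‖P₀ X‖ ≤ 2‖X‖`; `‖X − P₀ X‖ ≤ ‖X‖`
  have hP₀_herm0 : ∀ X : Matrix (Fin N) (Fin N) ℂ, X.IsHermitian → P₀ X ∈ herm0 (Fin N) := by
    intro X hX
    rw [mem_herm0, hP₀]
    refine ⟨?_, ?_⟩
    · have htr : star X.trace = X.trace := by rw [← Matrix.trace_conjTranspose, hX.eq]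
      unfold Matrix.IsHermitian
      rw [Matrix.conjTranspose_sub, hX.eq, Matrix.conjTranspose_smul, Matrix.conjTranspose_one, star_mul', htr, star_inv₀, Complex.star_def,
        Complex.conj_natCast]
    · have hN : (N : ℂ) ≠ 0 := by exact_mod_cast NeZero.ne N
      rw [Matrix.trace_sub, Matrix.trace_smul, Matrix.trace_one, Fintype.card_fin, smul_eq_mul, mul_assoc, mul_comm X.trace, ← mul_assoc,
        inv_mul_cancel₀ hN, one_mul, sub_self]
  have hP₀_fix : ∀ X : Matrix (Fin N) (Fin N) ℂ, X.trace = 0 → P₀ X = X := fun X hX => by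
    rw [hP₀, hX, mul_zero, zero_smul, sub_zero]
  have hP₀_norm : ∀ X : Matrix (Fin N) (Fin N) ℂ, ‖P₀ X‖ ≤ 2 * ‖X‖ := fun X => by
    rw [hP₀]
    have h1 : ‖((Fintype.card (Fin N) : ℂ)⁻¹ * X.trace) • (1 : Matrix (Fin N) (Fin N) ℂ)‖ ≤ ‖X‖ := by
      rw [norm_smul, norm_one, mul_one, inv_mul_eq_div]
      exact norm_ntr_le_opNorm X
    calc ‖X - ((Fintype.card (Fin N) : ℂ)⁻¹ * X.trace) • (1 : Matrix (Fin N) (Fin N) ℂ)‖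
        ≤ ‖X‖ + ‖((Fintype.card (Fin N) : ℂ)⁻¹ * X.trace) • (1 : Matrix (Fin N) (Fin N) ℂ)‖ := norm_sub_le _ _
      _ ≤ 2 * ‖X‖ := by linarith
  have hP₀_compl : ∀ X : Matrix (Fin N) (Fin N) ℂ, ‖X - P₀ X‖ ≤ ‖X‖ := fun X => by
    rw [hP₀, sub_sub_cancel, norm_smul, norm_one, mul_one, inv_mul_eq_div]
    exact norm_ntr_le_opNorm X
  -- `H₁ := † ∘ H ∘ †` is ℂ-linear
  let H₁ : (BondIdx D → Matrix (Fin N) (Fin N) ℂ) →ₗ[ℂ] (PBond P 0 → Matrix (Fin N) (Fin N) ℂ) :=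
    { toFun := fun X b => star (H (fun i => star (X i)) b)
      map_add' := fun X Y => by
        funext b
        have h : (fun i => star ((X + Y) i)) = (fun i => star (X i)) + (fun i => star (Y i)) := by
          funext i; simp only [Pi.add_apply, star_add]
        rw [h, map_add]; simp only [Pi.add_apply, star_add]
      map_smul' := fun c X => by
        funext b
        have h : (fun i => star ((c • X) i)) = (star c) • (fun i => star (X i)) := by
          funext i; simp only [Pi.smul_apply, star_smul]
        rw [h, map_smul]; simp only [Pi.smul_apply, RingHom.id_apply, star_smul, star_star] }
  have hH₁ : ∀ X b, H₁ X b = star (H (fun i => star (X i)) b) := fun _ _ => rfl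
  -- `H′ := ½ (H + H₁)`, then `H♮ := P₀∘H′ + H′∘(1 − P₀)`
  let H' : (BondIdx D → Matrix (Fin N) (Fin N) ℂ) →ₗ[ℂ] (PBond P 0 → Matrix (Fin N) (Fin N) ℂ) := (((1 / 2 : ℝ) : ℂ)) • (H + H₁)
  have hH' : ∀ X b, H' X b = ((1 / 2 : ℝ) : ℂ) • (H X b + star (H (fun i => star (X i)) b)) := fun X b => by
    show (((1 / 2 : ℝ) : ℂ) • ((H + H₁) X)) b = _
    rw [Pi.smul_apply, LinearMap.add_apply, Pi.add_apply, hH₁]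
  let Hn : (BondIdx D → Matrix (Fin N) (Fin N) ℂ) →ₗ[ℂ] (PBond P 0 → Matrix (Fin N) (Fin N) ℂ) :=
    (P₀.compLeft (PBond P 0)).comp H' + H'.comp ((LinearMap.id - P₀).compLeft (BondIdx D))
  have hHn : ∀ X b, Hn X b = P₀ (H' X b) + H' (fun i => X i - P₀ (X i)) b := fun X b => by
    show (P₀.compLeft (PBond P 0) (H' X) + H' ((LinearMap.id - P₀).compLeft (BondIdx D) X)) b = _
    rw [Pi.add_apply, LinearMap.compLeft_apply, Function.comp_apply]
    rfl
  -- the right-inverse property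
  have hinvH₁ : ∀ X, Qlin (H₁ X) = X := fun X => by
    funext idx
    have h := fderiv_chartLog_zero_comp_linear (((P.L : ℝ)⁻¹) ^ k) D σ (H (fun i => star (X i))) idx
    have hfun : (fun b => σ (H (fun i => star (X i)) b)) = H₁ X := funext fun b => by rw [hσ, hH₁]
    rw [hfun] at h
    rw [h, hHinv, hσ, star_star]
  have hinvH' : ∀ X, Qlin (H' X) = X := fun X => by
    show Qlin ((((1 / 2 : ℝ) : ℂ)) • ((H + H₁) X)) = X
    rw [map_smul, LinearMap.add_apply, map_add, hHinv, hinvH₁, ← two_smul ℂ X, smul_smul]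
    norm_num
  have hinvP₀ : ∀ Y : PBond P 0 → Matrix (Fin N) (Fin N) ℂ, ∀ idx, Qlin (fun b => P₀ (Y b)) idx = P₀ (Qlin Y idx) := fun Y idx =>
    fderiv_chartLog_zero_comp_linear (((P.L : ℝ)⁻¹) ^ k) D (P₀.restrictScalars ℝ) Y idx
  have hinvHn : ∀ X, Qlin (Hn X) = X := fun X => by
    funext idx
    have hfun : Hn X = (fun b => P₀ (H' X b)) + H' (fun i => X i - P₀ (X i)) := funext fun b => by rw [hHn]; rfl
    rw [hfun, map_add, Pi.add_apply, hinvP₀, hinvH', hinvH']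
    simp only [add_sub_cancel]
  -- the letters
  have hletH' : ∀ (X : BondIdx D → Matrix (Fin N) (Fin N) ℂ) (t : ℝ), 0 ≤ t → (∀ i, ‖X i‖ ≤ t) → ∀ b, w 1 b * ‖H' X b‖ ≤ B₀ * t := by
    intro X t ht hX b
    have h1 := hHB X t ht hX b
    have h2 := hHB (fun i => star (X i)) t ht (fun i => by
      rw [Matrix.star_eq_conjTranspose, Matrix.l2_opNorm_conjTranspose]; exact hX i) b
    rw [hH', Complex.coe_smul, norm_smul, Real.norm_eq_abs, abs_of_nonneg (by norm_num : (0 : ℝ) ≤ 1 / 2)]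
    have h3 : ‖H X b + star (H (fun i => star (X i)) b)‖ ≤ ‖H X b‖ + ‖H (fun i => star (X i)) b‖ := by
      refine (norm_add_le _ _).trans ?_
      rw [Matrix.star_eq_conjTranspose, Matrix.l2_opNorm_conjTranspose]
    have hw0 := (hwpos b).le
    nlinarith [mul_le_mul_of_nonneg_left h3 hw0]
  refine ⟨Hn, hinvHn, fun X t ht hX b => ?_, fun X hX b => ?_⟩
  · -- `w‖H♮ X b‖ ≤ 2·B₀t + B₀t`
    rw [hHn]
    have h1 : w 1 b * ‖P₀ (H' X b)‖ ≤ 2 * (B₀ * t) := by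
      have := mul_le_mul_of_nonneg_left (hP₀_norm (H' X b)) (hwpos b).le
      nlinarith [hletH' X t ht hX b]
    have h2 : w 1 b * ‖H' (fun i => X i - P₀ (X i)) b‖ ≤ B₀ * t :=
      hletH' (fun i => X i - P₀ (X i)) t ht (fun i => (hP₀_compl (X i)).trans (hX i)) b
    have h3 : w 1 b * ‖P₀ (H' X b) + H' (fun i => X i - P₀ (X i)) b‖ ≤ w 1 b * ‖P₀ (H' X b)‖ + w 1 b * ‖H' (fun i => X i - P₀ (X i)) b‖ := by
      rw [← mul_add]; exact mul_le_mul_of_nonneg_left (norm_add_le _ _) (hwpos b).le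
    linarith
  · -- Hermitian traceless data give Hermitian traceless fields
    rw [hHn]
    have hX0 : (fun i => X i - P₀ (X i)) = 0 := funext fun i => by
      rw [Pi.zero_apply, hP₀_fix (X i) ((mem_herm0).1 (hX i)).2, sub_self]
    rw [hX0, map_zero, Pi.zero_apply, add_zero]
    refine hP₀_herm0 _ ?_
    -- `H′ X b` is Hermitian for Hermitian-valued `X`
    have hXs : (fun i => star (X i)) = X := funext fun i => by
      rw [Matrix.star_eq_conjTranspose]; exact ((mem_herm0).1 (hX i)).1.eq
    unfold Matrix.IsHermitian
    rw [hH', hXs, Complex.coe_smul, Matrix.conjTranspose_smul, star_trivial, Matrix.conjTranspose_add, ← Matrix.star_eq_conjTranspose,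
      ← Matrix.star_eq_conjTranspose, star_star, add_comm]

/-! ## §3 [15] Proposition 3 at NODE 00's record over print's `𝔤` -/

/-- ★★★★ **[15] PROPOSITION 3 AT NODE 00's RECORD OVER THE REAL LIE ALGEBRA `𝔤` (Hermitian traceless), NO DISPLAYED OPERATOR HYPOTHESIS.**  For every `F : T4Family` there are
thresholds `Mh₀, R₀` and `B ≥ 0` such that for all record data (the binders of `N07Prop3AtRecord.exists_prop3_T4`), every `ε > 0` with `18C₂Bε ≤ 1`, `64ε ≤ R⋆` and the guard
budget `120ℓ²Lε < δ_N`: there are a ℂ-linear right inverse `H` of `D(chartLog η D)(0)` with the weighted (46) letter `B` WHICH MAPS HERMITIAN TRACELESS DATA TO HERMITIAN TRACELESS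
FIELDS, and a map `Dfun`, ℂ-differentiable on the weighted `ε`-ball, with (55), (49), (48), `HasFDerivAt` + (73) at every point of the ball, such that for every Hermitian-traceless-valued
`A′` in the ball `Dfun A′` and `A = A′ − H·Dfun A′` are Hermitian traceless — «A with values in 𝔤» (p. 285).  (`exists_prop3_T4` gives the right inverse of record; §2 symmetrises
it; `N07ChartDDerivative.exists_chartD_hasFDerivAt` gives the chart for it; `N07ChartLogReality.chartD_valued_herm0` gives reality.)
[cite: Balaban1985Variational, Prop. 3 p.289, (43)-(49) p.285, (55) p.286, (73) p.289, (152)-(157) pp.301-302; Balaban1984PropagatorsII, Cor. 2.8 p.249; Balaban1987RG1, (0.1) p.251] -/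
theorem exists_prop3_T4_herm0 (F : T4Family) :
    ∃ (Mh₀ R₀ : ℕ) (B : ℝ), 0 ≤ B ∧
    ∀ (n K : ℕ) (_ : 1 ≤ K - n) (_ : K - n + 1 ≤ F.m + K) {Mh R a' : ℕ} (_ : Mh = F.L ^ a') (_ : Mh₀ ≤ Mh) (_ : R₀ ≤ R) (_ : 2 * F.L ≤ R)
      (_ : a' + 3 ≤ F.m + n) (D : Domains (F.P K)) (_ : D.k = K - n) (_ : Adm22 D R (F.L * Mh))
      (w : ℕ → PBond (F.P K) 0 → ℝ) (_ : IsLevWeight (F.P K) (K - n) D w) {ε : ℝ} (_ : 0 < ε)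
      (_ : 18 * (960 * ((((F.P K).d + 2) * (F.P K).L : ℕ) : ℝ) * ((F.P K).L : ℝ) / (12800 * ((((F.P K).d + 2) * (F.P K).L : ℕ) : ℝ) ^ 2 * ((F.P K).L : ℝ))⁻¹) *
        B * ε ≤ 1)
      (_ : 64 * ε ≤ (12800 * ((((F.P K).d + 2) * (F.P K).L : ℕ) : ℝ) ^ 2 * ((F.P K).L : ℝ))⁻¹)
      (_ : 120 * ((((F.P K).d + 2) * (F.P K).L : ℕ) : ℝ) ^ 2 * ((F.P K).L : ℝ) * ε < deltaSU (Fin N)),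
      let η : ℝ := (((F.P K).L : ℝ)⁻¹) ^ (K - n)
      let Rs : ℝ := (12800 * ((((F.P K).d + 2) * (F.P K).L : ℕ) : ℝ) ^ 2 * ((F.P K).L : ℝ))⁻¹
      let C₂ : ℝ := 960 * ((((F.P K).d + 2) * (F.P K).L : ℕ) : ℝ) * ((F.P K).L : ℝ) / Rs
      let C₃ : ℝ := 3840 * ((((F.P K).d + 2) * (F.P K).L : ℕ) : ℝ) * ((F.P K).L : ℝ) / Rs
      let Qlin := (fderiv ℂ (chartLog η D : (PBond (F.P K) 0 → Matrix (Fin N) (Fin N) ℂ) → BondIdx D → Matrix (Fin N) (Fin N) ℂ) 0)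
      ∃ (H : (BondIdx D → Matrix (Fin N) (Fin N) ℂ) →ₗ[ℂ] (PBond (F.P K) 0 → Matrix (Fin N) (Fin N) ℂ))
        (Dfun : (PBond (F.P K) 0 → Matrix (Fin N) (Fin N) ℂ) → (BondIdx D → Matrix (Fin N) (Fin N) ℂ)),
        (∀ X, Qlin (H X) = X) ∧
        (∀ (X : BondIdx D → Matrix (Fin N) (Fin N) ℂ) (t : ℝ), 0 ≤ t → (∀ i, ‖X i‖ ≤ t) → ∀ b, w 1 b * ‖H X b‖ ≤ B * t) ∧
        (∀ X : BondIdx D → Matrix (Fin N) (Fin N) ℂ, (∀ i, X i ∈ herm0 (Fin N)) → ∀ b, H X b ∈ herm0 (Fin N)) ∧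
        DifferentiableOn ℂ Dfun {A' : PBond (F.P K) 0 → Matrix (Fin N) (Fin N) ℂ | ∀ b, w 1 b * ‖A' b‖ < ε} ∧
        (∀ A' : PBond (F.P K) 0 → Matrix (Fin N) (Fin N) ℂ, (∀ b, w 1 b * ‖A' b‖ < ε) →
          (∀ (ρ : ℝ), 0 ≤ ρ → (∀ b, w 1 b * ‖A' b‖ ≤ ρ) → ∀ i, ‖Dfun A' i‖ ≤ 4 * C₂ * ρ ^ 2) ∧
          chartLog η D (A' - H (Dfun A')) - Qlin (A' - H (Dfun A')) = Dfun A' ∧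
          chartLog η D (A' - H (Dfun A')) = Qlin A' ∧
          ∃ 𝔇 : (PBond (F.P K) 0 → Matrix (Fin N) (Fin N) ℂ) →L[ℂ] (BondIdx D → Matrix (Fin N) (Fin N) ℂ), HasFDerivAt Dfun 𝔇 A' ∧
            ∀ (W : PBond (F.P K) 0 → Matrix (Fin N) (Fin N) ℂ) (t : ℝ), 0 ≤ t → (∀ b, w 1 b * ‖W b‖ ≤ t) → ∀ i, ‖𝔇 W i‖ ≤ 4 * C₃ * ε * t) ∧
        (∀ A' : PBond (F.P K) 0 → Matrix (Fin N) (Fin N) ℂ, (∀ b, w 1 b * ‖A' b‖ < ε) → (∀ b, A' b ∈ herm0 (Fin N)) →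
          (∀ i, Dfun A' i ∈ herm0 (Fin N)) ∧ ∀ b, (A' - H (Dfun A')) b ∈ herm0 (Fin N)) := by
  obtain ⟨Mh₀, R₀, B₁, hB₁, hmain⟩ := exists_prop3_T4 (ι := Fin N) F
  refine ⟨Mh₀, R₀, 3 * B₁, by positivity, ?_⟩
  intro n K hk1 hk' Mh R a' hMha hMh hR h2L hsize D hDk hAdm w hw ε hε h18 h64 hδ
  -- positivity of the letters at `F.P K`
  have hL0 : (0 : ℝ) < (F.P K).L := by exact_mod_cast (F.P K).L_pos
  have hℓ1 : (1 : ℝ) ≤ ((((F.P K).d + 2) * (F.P K).L : ℕ) : ℝ) := by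
    exact_mod_cast Nat.one_le_iff_ne_zero.mpr (Nat.mul_ne_zero (by omega) (by have := (F.P K).hL.2; omega))
  have hden : 0 < 12800 * ((((F.P K).d + 2) * (F.P K).L : ℕ) : ℝ) ^ 2 * ((F.P K).L : ℝ) := by positivity
  have hC₂ : 0 ≤ 960 * ((((F.P K).d + 2) * (F.P K).L : ℕ) : ℝ) * ((F.P K).L : ℝ) /
      (12800 * ((((F.P K).d + 2) * (F.P K).L : ℕ) : ℝ) ^ 2 * ((F.P K).L : ℝ))⁻¹ := by positivity
  -- a window for the record's right inverse (its letters do not depend on it)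
  obtain ⟨ε₁, hε₁, h18₁, h64₁⟩ := exists_eps_chartDDeriv hC₂ hB₁ (inv_pos.mpr hden)
  obtain ⟨H₁, -, hHinv₁, hHB₁, -⟩ := hmain n K hk1 hk' hMha hMh hR h2L hsize D hDk hAdm w hw hε₁ h18₁ h64₁
  -- symmetrise and project
  obtain ⟨H, hHinv, hHB, hSH⟩ := exists_herm0Valued_rightInverse (K - n) D hw H₁ hHinv₁ hHB₁
  have hM1 : 1 ≤ F.L * Mh := by
    have hL := F.hL.2
    rw [hMha]; exact Nat.one_le_iff_ne_zero.mpr (Nat.mul_ne_zero (by omega) (pow_ne_zero _ (by omega)))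
  have h2L' : 2 * (F.P K).L ≤ R := h2L
  have hB3 : 0 ≤ 3 * B₁ := by positivity
  obtain ⟨Dfun, hdiff, hD⟩ := exists_chartD_hasFDerivAt (n := Fin N) (K - n) h2L' hM1 D hDk hAdm hw H hHinv hB3 hHB hε h18 h64
  refine ⟨H, Dfun, hHinv, hHB, hSH, hdiff, hD, fun A' hA' hA'h => ?_⟩
  exact chartD_valued_herm0 (K - n) h2L' hM1 D hDk hAdm hw H hB3 hHB hε h18 h64 hδ hSH Dfun (fun A hA => (hD A hA).1)
    (fun A hA => (hD A hA).2.1) A' hA' hA'h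

end Summit.QuantumFields.YangMills.BalabanUVNodes.N07ChartHValued

end
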